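import Summits.QuantumFields.YangMills.Theorems.BalabanUVNodesN12DirectChartPackage
import Summits.QuantumFields.YangMills.Theorems.BalabanUVNodesN12DirectChartLetterHSupportVacuity

/-!
# DAG node N12 [B15] — THE DIRECT ROAD's CHART HALF ON THE REPAIRED (P4)′ SOCKET: `chartRows_direct_of_letters'` and `exists_hWD_chartHalf_of_letters'` WITHOUT the support clause
# `hHsupp` (LOCATED-P4-LETTER: dag-n08-c p657858 ∕ dag-n12-w6; lane ruling 2026-08-28 18:4xZ)

[Balaban1989LargeFieldII] = «[LF-II]», p. 357, (1.12)–(1.13) p. 359; [Balaban1985Variational] = «[15]», Sect. C (44)–(48) p. 285, (81)–(83) p. 290; [Balaban1988Convergent] = «[III]»,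
(2.2) p. 255, (2.10)–(2.13) pp. 256–257.

Cell `pub-ymgap`, HUMAN RULINGS D-0062 ∕ D-0149, lane owner `pub-ymgap-dag-n12-c` (g20) on node N12 (plan g87's ruling «(b-direct) GO»; pen (3a)∕(3b) of the lane's ruling on
LOCATED-P4-LETTER, dag-n12-w4 g5 having closed).  Key K1⁹ `stmt-QuantumFields-27364`, `--kind proof --supports … --as helper`; count-neutral.  NEW leaf; CONSUMED BY NAME, nothing
modified: dag-n12-w4's `N12DirectChartLetterCore` (p654775) and `N12DirectChartPackage` (p657510), dag-n08-c's `N12DirectChartLetterHSupportVacuity` (p657858: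
`hHsupp_levelZeroFree_of_rightInverse`, `fderiv_fderiv_msChart_levelZeroFree_direct`).

WHY.  p654775's displayed right-inverse letter carried a support clause `hHsupp : ∀ v b, b.src ∉ Ω₁(Z) → H v b = 0` which, together with `hHinv`, is unsatisfiable as soon as
`0 < k` and `Ω₁(Z) ≠ 𝕋` (the level-0 rows of the linearised chart ARE the `Γ₀`-bonds; p657858 `not_exists_hH_direct`).  The proof used it only at the ONE datum `v = Ψ₂ w w`, which is
level-0-free (`fderiv_fderiv_msChart_levelZeroFree_direct`), where the clause holds for EVERY right inverse (`hHsupp_levelZeroFree_of_rightInverse`).  THIS FILE re-states both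
theorems with the support clause DROPPED and `0 < k` added; the (P4)′ socket is thereby «a right inverse of `DΨ_{U₀}(0)` with a letter `B`», nothing about supports.

CONTENTS (namespace `Summit.QuantumFields.YangMills.BalabanUVNodes.N12DirectChartPackageRepaired`; theorems only — no `def`, no `instance`, no `sorry`).
* §1 ★★★ `chartRows_direct_of_letters'` — p654775's rows with `hHsupp` dropped (`hk0 : 0 < k` added); same constants.
* §2 ★★★ `exists_hWD_chartHalf_of_letters'` — p657510's chart half of the (WD) package over §1, `hHsupp` dropped.

HONEST FRAMING ∕ LOCATED.  Composition by name; `hH = (H, hHinv, hHB)` (the (P4)′ target, dag-n12-w6 g6's pen) and `hM₂` (p656421 at a compact guard) stay DISPLAYED; per-height ∕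
per-instance constants, NOT print's volume-uniform ones; nothing of Bałaban's (1.7) ∕ (1.12) ∕ Prop. 1 is asserted; count-neutral helper; N12 NOT discharged; K1⁹ NOT closed; counts
unmoved; one finite 𝕋⁴ programme at fixed ε — R4 closes the conditional finite-𝕋⁴ rung `BalabanLadder.UV` only; NOT continuum ∕ OS ∕ mass gap ∕ Clay.
-/

noncomputable section
open scoped BigOperators Matrix.Norms.L2Operator Topology
open Filter Finset

namespace Summit.QuantumFields.YangMills.BalabanUVNodes.N12DirectChartPackageRepaired

open Literature.MathematicalPhysics.QuantumFieldTheory.Balaban1983to89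
open Literature.MathematicalPhysics.QuantumLattice (quatMatrix)
open T4Continuum (T4Family)
open T4HaarSU2ExpChart (imQuat)
open T4AdjointCovarianceUnitary (lieSU)
open T4CubeChartGnomonic (SU2)
open B15DeterminingSets GaugeField
open B14.Eq213DetSet (Bj Bj_of_gt maxDomT)
open B14.Eq216Concrete (feeds)
open B15Prop1SliceCoordinates (GaugeSlice ιA)
open B15Prop1ChartCalculusSU2 (E3)
open B15Prop1ChartSU2 (su2Chart)
open B16Sect1Backgrounds (expMul)
open T4AxialGaugeSmallField (castSite)
open B6TreeGaugePoincare (curl)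
open B16Eq18Proof (box)
open LatticeFieldCalculus (runSite)
open BlockAveragingEMLLinearised (linAvg)
open Literature.MathematicalPhysics.QuantumFieldTheory.BalabanImbrieJaffe1984to88.BIJ85Eq453GaugeField (qsstarGIter0)
open Node00
open B16Ineq19FlatSliceChart (exists_lieSU2Coord)
open Summit.QuantumFields.YangMills.BalabanUVNodes.N12NearFlatChartLetter (sum_opNorm_sq_le_l2Seminorm_sq l2Seminorm_le_of_bound_of_support
  l2Seminorm_le_sqrt_card_mul_norm sum_opNorm_le_sqrt_card_mul_l2Seminorm l2Seminorm_apply)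
open Summit.QuantumFields.YangMills.BalabanUVNodes.N12RightInverseLevelZeroLocality (mem_bondsOf_Bj_zero)
open B16Ineq17NearFlatWilsonLetters (fderiv_wilsonAction4_expChart_apply_eq_deriv)
open Summit.QuantumFields.YangMills.BalabanUVNodes.N12NearFlatFederbushFibreRecord (hcons_of_plaqsInside_maxDomT)
open Summit.QuantumFields.YangMills.BalabanUVNodes.N12NearFlatFederbushFibreWindowKnit (runSite_runSite_blockSite_mem_tower)
open Summit.QuantumFields.YangMills.BalabanUVNodes.N12NearFlatFederbushVelocityWindow (exists_hmX_federbush_window_of_isMinimizer_family)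
open Summit.QuantumFields.YangMills.BalabanUVNodes.N12DirectChartLetterCore (exists_twistSize_of_nearFlat_feeds abs_fderiv_wilsonAction4_expChart_apply_le_of_plaqSmall norm_le_sqrt_sum_sq)
open Summit.QuantumFields.YangMills.BalabanUVNodes.N12DirectChartLetterHSupportVacuity (hHsupp_levelZeroFree_of_rightInverse fderiv_fderiv_msChart_levelZeroFree_direct)

variable {F : T4Family}

/-! ## §1  The chart rows on the repaired socket -/

section Core

/-- ★★★ **THE DIRECT CHART ROWS ON THE REPAIRED (P4)′ SOCKET** — dag-n12-w4's `N12DirectChartLetterCore.chartRows_direct_of_letters` (p654775) VERBATIM except: the displayed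
right-inverse letter is `(H, hHinv, hHB)` WITHOUT the support clause `hHsupp` (LOCATED-P4-LETTER: with `hHinv` it was unsatisfiable for `0 < k`, `Ω₁(Z) ≠ 𝕋` — dag-n08-c p657858
`not_exists_hH_direct`), and `hk0 : 0 < k` is added.  Inside, the multiplier bound is proved for LEVEL-0-FREE data `v` only (there the support clause holds for every right inverse,
`hHsupp_levelZeroFree_of_rightInverse`) and applied at the one datum `v = Ψ₂ w w`, which is level-0-free (`fderiv_fderiv_msChart_levelZeroFree_direct`).  Same outputs and constants:
`∃ Ψ₂ λ p, hΨ₂ ∧ hΨd ∧ hlam ∧ hp ∧ (p∘H ≤ B‖·‖) ∧ ∀ X, (μ) ≤ (2(d−1)·εP·√#bonds·B·M₂)·p(X_f′X)² ∧ (K) p(X_f′X) ≤ (12𝓐₀∕R·√card)·‖X‖`.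
[cite: Balaban1989LargeFieldII, p.357, (1.12)–(1.13) p.359; Balaban1985Variational, Sect. C (44)–(48) p.285, (81)–(83) p.290; Balaban1988Convergent, (2.2) p.255, (2.11)–(2.12) p.256] -/
theorem chartRows_direct_of_letters' (ν : Node00.Stage7Numerics) (Kt : ℕ) {k : ℕ} (hk0 : 0 < k)
    (Z Λ : Set (Site (F.P Kt) 0)) (T : Finset (PBond (F.P Kt) k))
    (ext : GaugeField (F.P Kt) k SU2 → GaugeField (F.P Kt) k SU2) (Vk : GaugeField (F.P Kt) k SU2) {R 𝓐₀ : ℝ} (hR : 0 < R) (h𝓐₀ : 0 ≤ 𝓐₀)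
    (U₀ : GaugeField (F.P Kt) 0 SU2) (Xf : GaugeSlice (pts k Λ) T E3 → PBond (F.P Kt) 0 → lieSU (Fin 2))
    (hmin0 : IsMinimizer (Node00.avOfRecord F 2 Kt) (Node00.regMSCoPOfRecord F 2 ν Kt k (maxDomT ν.M₁ Z)) (Bj ν.M₁ Z k)
      (avgFamily (Node00.avOfRecord F 2 Kt) (qsstarGIter0 k (ext Vk))) U₀)
    -- the gauge-invariant guard at `U₀` (displayed)
    (hsb : SmallBelow (Node00.avOfRecord F 2 Kt) k U₀)
    -- P1: plaquette smallness where the first variation is read (displayed, gauge-invariant)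
    {εP : ℝ} (hεP0 : 0 ≤ εP)
    (hP : ∀ p : Plaq (F.P Kt) 0, ((⟨p.src, p.μ⟩ : PBond (F.P Kt) 0) ∈ {b : PBond (F.P Kt) 0 | b.src ∈ maxDomT ν.M₁ Z 1} ∨
          (⟨p.src.shift p.μ, p.ν⟩ : PBond (F.P Kt) 0) ∈ {b : PBond (F.P Kt) 0 | b.src ∈ maxDomT ν.M₁ Z 1} ∨
          (⟨p.src.shift p.ν, p.μ⟩ : PBond (F.P Kt) 0) ∈ {b : PBond (F.P Kt) 0 | b.src ∈ maxDomT ν.M₁ Z 1} ∨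
          (⟨p.src, p.ν⟩ : PBond (F.P Kt) 0) ∈ {b : PBond (F.P Kt) 0 | b.src ∈ maxDomT ν.M₁ Z 1}) →
      ‖((GaugeField.plaqHol U₀ p : SU2) : Matrix (Fin 2) (Fin 2) ℂ) - 1‖ ≤ εP)
    -- hH: the curved right inverse WITHOUT the support clause (the repaired (P4)′ socket): right inverse + letter only
    (H : (Fin (constrCard (Bj ν.M₁ Z k) k) → lieSU (Fin 2)) → PBond (F.P Kt) 0 → lieSU (Fin 2)) {B : ℝ} (hB0 : 0 ≤ B)
    (hHinv : ∀ v, fderiv ℝ (msChart F 2 Kt k (Bj ν.M₁ Z k) (avgFamily (avOfRecord F 2 Kt) (qsstarGIter0 k (ext Vk))) U₀) 0 (H v) = v)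
    (hHB : ∀ v, Real.sqrt (∑ b, ‖H v b‖ ^ 2) ≤ B * ‖v‖)
    -- hM₂: the chart curvature at `U₀` (displayed)
    {M₂ : ℝ} (hM₂0 : 0 ≤ M₂)
    (hM₂ : ∀ w, ‖fderiv ℝ (fderiv ℝ (msChart F 2 Kt k (Bj ν.M₁ Z k) (avgFamily (avOfRecord F 2 Kt) (qsstarGIter0 k (ext Vk))) U₀)) 0 w w‖ ≤ M₂ * ‖w‖ ^ 2)
    -- the (K′) family's velocity letters, as in (χ)_N
    (hKb : ∀ (X : GaugeSlice (pts k Λ) T E3) (b : PBond (F.P Kt) 0),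
      ‖((fderiv ℝ Xf 0 X b : lieSU (Fin 2)) : Matrix (Fin 2) (Fin 2) ℂ)‖ ≤ 8 * 𝓐₀ / R * ‖X‖ ∧ ‖fderiv ℝ Xf 0 X b‖ ≤ 12 * 𝓐₀ / R * ‖X‖)
    (hsupp : ∀ (X : GaugeSlice (pts k Λ) T E3) (b : PBond (F.P Kt) 0), b.src ∉ maxDomT ν.M₁ Z 1 → fderiv ℝ Xf 0 X b = 0) :
    ∃ (Ψ₂ : (PBond (F.P Kt) 0 → lieSU (Fin 2)) →L[ℝ] (PBond (F.P Kt) 0 → lieSU (Fin 2)) →L[ℝ] (Fin (constrCard (Bj ν.M₁ Z k) k) → lieSU (Fin 2)))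
      (lam : (Fin (constrCard (Bj ν.M₁ Z k) k) → lieSU (Fin 2)) →L[ℝ] ℝ)
      (p : Seminorm ℝ (PBond (F.P Kt) 0 → lieSU (Fin 2))),
      HasFDerivAt (fun Y => fderiv ℝ (msChart F 2 Kt k (Bj ν.M₁ Z k) (avgFamily (avOfRecord F 2 Kt) (qsstarGIter0 k (ext Vk))) U₀) Y) Ψ₂ 0 ∧
      (∀ᶠ Y in 𝓝 (0 : PBond (F.P Kt) 0 → lieSU (Fin 2)), DifferentiableAt ℝ (msChart F 2 Kt k (Bj ν.M₁ Z k) (avgFamily (avOfRecord F 2 Kt) (qsstarGIter0 k (ext Vk))) U₀) Y) ∧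
      fderiv ℝ (fun Y : PBond (F.P Kt) 0 → lieSU (Fin 2) => wilsonAction4 (expChart U₀ Y)) 0 = lam.comp (fderiv ℝ (msChart F 2 Kt k (Bj ν.M₁ Z k) (avgFamily (avOfRecord F 2 Kt) (qsstarGIter0 k (ext Vk))) U₀) 0) ∧
      (∀ Y : PBond (F.P Kt) 0 → lieSU (Fin 2), ∑ b, ‖(Y b : Matrix (Fin 2) (Fin 2) ℂ)‖ ^ 2 ≤ p Y ^ 2) ∧
      (∀ v, p (H v) ≤ B * ‖v‖) ∧
      ∀ X : GaugeSlice (pts k Λ) T E3,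
        lam (Ψ₂ (fderiv ℝ Xf 0 X) (fderiv ℝ Xf 0 X))
            ≤ (2 * (((F.P Kt).d : ℝ) - 1) * εP * Real.sqrt (Fintype.card (PBond (F.P Kt) 0)) * B * M₂) * p (fderiv ℝ Xf 0 X) ^ 2 ∧
        p (fderiv ℝ Xf 0 X) ≤ (12 * 𝓐₀ / R * Real.sqrt (Nat.card {b : PBond (F.P Kt) 0 // b.src ∈ maxDomT ν.M₁ Z 1})) * ‖X‖ := by
  classical
  -- ### the junction's seminorm `p := bond-ℓ²(HS)` and its letters (as in (χ)_N)
  let p : Seminorm ℝ (PBond (F.P Kt) 0 → lieSU (Fin 2)) :=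
    (normSeminorm ℝ (PiLp 2 (fun _ : PBond (F.P Kt) 0 => lieSU (Fin 2)))).comp (WithLp.linearEquiv 2 ℝ (PBond (F.P Kt) 0 → lieSU (Fin 2))).symm.toLinearMap
  have hp : ∀ Y : PBond (F.P Kt) 0 → lieSU (Fin 2), ∑ b, ‖(Y b : Matrix (Fin 2) (Fin 2) ℂ)‖ ^ 2 ≤ p Y ^ 2 := fun Y => sum_opNorm_sq_le_l2Seminorm_sq Y
  let n : ℝ := Real.sqrt (Fintype.card (PBond (F.P Kt) 0))
  have hn0 : 0 ≤ n := Real.sqrt_nonneg _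
  have hpl1 : ∀ Y : PBond (F.P Kt) 0 → lieSU (Fin 2), ∑ b, ‖(Y b : Matrix (Fin 2) (Fin 2) ℂ)‖ ≤ n * p Y := fun Y => sum_opNorm_le_sqrt_card_mul_l2Seminorm Y
  have hpY : ∀ Y : PBond (F.P Kt) 0 → lieSU (Fin 2), p Y = Real.sqrt (∑ b, ‖Y b‖ ^ 2) := fun Y => l2Seminorm_apply Y
  have hsupY : ∀ Y : PBond (F.P Kt) 0 → lieSU (Fin 2), ‖Y‖ ≤ p Y := fun Y => by rw [hpY]; exact norm_le_sqrt_sum_sq Y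
  have hpH : ∀ v, p (H v) ≤ B * ‖v‖ := fun v => by rw [hpY]; exact hHB v
  -- ### fibre, regularity, multiplier
  have hUfib : AgreeOn (Bj ν.M₁ Z k) (avgFamily (avOfRecord F 2 Kt) U₀) (avgFamily (avOfRecord F 2 Kt) (qsstarGIter0 k (ext Vk))) := hmin0.2.1
  obtain ⟨hΨ₂, hΨd⟩ := regularity_binders_msChart (k := k) (𝔹 := Bj ν.M₁ Z k) hUfib hsb
  have hsurj : Function.Surjective (fderiv ℝ (msChart F 2 Kt k (Bj ν.M₁ Z k) (avgFamily (avOfRecord F 2 Kt) (qsstarGIter0 k (ext Vk))) U₀) 0) := fun v => ⟨H v, hHinv v⟩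
  obtain ⟨lam, hlam⟩ := exists_lam_msChart_Bj_of_isMinimizer_regMSCoPOfRecord ν (maxDomT ν.M₁ Z) ν.M₁ Z hmin0 hsb hsurj
  -- ### the multiplier bound from the PLAQUETTE-SMALL current factor on the range of `H`
  have hd1 : 0 ≤ ((F.P Kt).d : ℝ) - 1 := by
    have h1 : (1 : ℝ) ≤ (F.P Kt).d := by exact_mod_cast (F.P Kt).hd
    linarith
  have hlamv : ∀ v : Fin (constrCard (Bj ν.M₁ Z k) k) → lieSU (Fin 2),
      (∀ (c : PBond (F.P Kt) 0) (hc : c.src ∉ maxDomT ν.M₁ Z 1),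
        v (constrEnum (Bj ν.M₁ Z k : DetSet (F.P Kt)) k ⟨⟨0, Nat.succ_pos k⟩, c, (mem_bondsOf_Bj_zero hk0 Z c).2 (Or.inl hc)⟩) = 0) →
      |lam v| ≤ (2 * (((F.P Kt).d : ℝ) - 1) * εP * n * B) * ‖v‖ := by
    intro v hv
    -- the repaired support clause holds for EVERY right inverse at level-0-free data (dag-n08-c p657858)
    have hHsuppv : ∀ b : PBond (F.P Kt) 0, b.src ∉ maxDomT ν.M₁ Z 1 → H v b = 0 :=
      fun b hb => hHsupp_levelZeroFree_of_rightInverse hk0 hUfib hsb H hHinv v hv b hb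
    have h1 : lam v = fderiv ℝ (fun Y : PBond (F.P Kt) 0 → lieSU (Fin 2) => wilsonAction4 (expChart U₀ Y)) 0 (H v) := by
      rw [hlam, ContinuousLinearMap.comp_apply, hHinv]
    rw [h1]
    calc |fderiv ℝ (fun Y : PBond (F.P Kt) 0 → lieSU (Fin 2) => wilsonAction4 (expChart U₀ Y)) 0 (H v)|
        ≤ 2 * (((F.P Kt).d : ℝ) - 1) * εP * ∑ b : PBond (F.P Kt) 0, ‖(H v b : Matrix (Fin 2) (Fin 2) ℂ)‖ :=
          abs_fderiv_wilsonAction4_expChart_apply_le_of_plaqSmall ν Z U₀ hP (H v) hHsuppv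
      _ ≤ 2 * (((F.P Kt).d : ℝ) - 1) * εP * (n * p (H v)) := mul_le_mul_of_nonneg_left (hpl1 (H v)) (by positivity)
      _ ≤ 2 * (((F.P Kt).d : ℝ) - 1) * εP * (n * (B * ‖v‖)) := by gcongr; exact hpH v
      _ = (2 * (((F.P Kt).d : ℝ) - 1) * εP * n * B) * ‖v‖ := by ring
  -- ### assemble
  refine ⟨fderiv ℝ (fderiv ℝ (msChart F 2 Kt k (Bj ν.M₁ Z k) (avgFamily (avOfRecord F 2 Kt) (qsstarGIter0 k (ext Vk))) U₀)) 0, lam, p, hΨ₂, hΨd, hlam, hp, hpH, fun X => ⟨?_, ?_⟩⟩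
  · -- (μ): multiplier bound × curvature letter × `‖w‖ ≤ p(w)`
    have hw := hsupY (fderiv ℝ Xf 0 X)
    have hw0 : 0 ≤ ‖fderiv ℝ Xf 0 X‖ := norm_nonneg _
    have hc0 : 0 ≤ 2 * (((F.P Kt).d : ℝ) - 1) * εP * n * B := by positivity
    calc lam (fderiv ℝ (fderiv ℝ (msChart F 2 Kt k (Bj ν.M₁ Z k) (avgFamily (avOfRecord F 2 Kt) (qsstarGIter0 k (ext Vk))) U₀)) 0 (fderiv ℝ Xf 0 X) (fderiv ℝ Xf 0 X))
        ≤ |lam (fderiv ℝ (fderiv ℝ (msChart F 2 Kt k (Bj ν.M₁ Z k) (avgFamily (avOfRecord F 2 Kt) (qsstarGIter0 k (ext Vk))) U₀)) 0 (fderiv ℝ Xf 0 X) (fderiv ℝ Xf 0 X))| := le_abs_self _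
      _ ≤ (2 * (((F.P Kt).d : ℝ) - 1) * εP * n * B) * ‖fderiv ℝ (fderiv ℝ (msChart F 2 Kt k (Bj ν.M₁ Z k) (avgFamily (avOfRecord F 2 Kt) (qsstarGIter0 k (ext Vk))) U₀)) 0 (fderiv ℝ Xf 0 X) (fderiv ℝ Xf 0 X)‖ :=
          hlamv _ (fun c hc => fderiv_fderiv_msChart_levelZeroFree_direct ν Kt Z ext Vk U₀ hmin0 hsb _ _ c _)
      _ ≤ (2 * (((F.P Kt).d : ℝ) - 1) * εP * n * B) * (M₂ * ‖fderiv ℝ Xf 0 X‖ ^ 2) := mul_le_mul_of_nonneg_left (hM₂ _) hc0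
      _ ≤ (2 * (((F.P Kt).d : ℝ) - 1) * εP * n * B) * (M₂ * p (fderiv ℝ Xf 0 X) ^ 2) := by
          refine mul_le_mul_of_nonneg_left (mul_le_mul_of_nonneg_left ?_ hM₂0) hc0
          exact pow_le_pow_left₀ hw0 hw 2
      _ = (2 * (((F.P Kt).d : ℝ) - 1) * εP * n * B * M₂) * p (fderiv ℝ Xf 0 X) ^ 2 := by ring
  · -- (K) from the per-bond velocity bound and the support letter (as in (χ)_N)
    have ha : 0 ≤ 12 * 𝓐₀ / R * ‖X‖ := by positivity
    have h := l2Seminorm_le_of_bound_of_support (N := 2) (maxDomT ν.M₁ Z 1) (fderiv ℝ Xf 0 X) ha (fun b => (hKb X b).2) (fun b hb => hsupp X b hb)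
    calc p (fderiv ℝ Xf 0 X) ≤ Real.sqrt (Nat.card {b : PBond (F.P Kt) 0 // b.src ∈ maxDomT ν.M₁ Z 1}) * (12 * 𝓐₀ / R * ‖X‖) := h
      _ = (12 * 𝓐₀ / R * Real.sqrt (Nat.card {b : PBond (F.P Kt) 0 // b.src ∈ maxDomT ν.M₁ Z 1})) * ‖X‖ := by ring

end Core

/-! ## §2  The chart half of the (WD) package on the repaired socket -/

section Package

/-- ★★★ **THE CHART HALF OF THE WINDOW∕DIRECT PACKAGE (WD) ON THE REPAIRED SOCKET** — dag-n12-w4's `N12DirectChartPackage.exists_hWD_chartHalf_of_letters` (p657510) VERBATIM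
except that the support clause `hHsupp` is dropped from the ∀-chain (and `hk0 : 0 < k` added); the per-height constants `C ρ K_τ ρ_τ`, the inputs (`hmin0`, `hsb`, `hP`, `(H, hHinv, hHB)`,
`hM₂`, the (K′) family letters, the window `W ⊇` tower-0 plaquettes, the tower near-flatness `δ_W`) and the conclusion (`∃ Ψ₂ λ p, … ∀ X, (μ) ∧ (K) ∧ hmX` — the lane's (χ)_W letter
of `B15Prop1WindowDirectPackageFromLetters`) are unchanged.  Proof: p657510's, over §1.
[cite: Balaban1989LargeFieldII, p.357, (1.7) p.358, (1.12)–(1.13) p.359; Balaban1985Variational, (45) p.285, (81)–(83) p.290, (172) p.305; Balaban1988Convergent, (2.2) p.255, (2.10)–(2.13) pp.256–257] -/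
theorem exists_hWD_chartHalf_of_letters' (ν : Node00.Stage7Numerics) (Kt : ℕ) (h0 : 0 < (F.P Kt).d) {k : ℕ} (hk0 : 0 < k) (hk : k ≤ (F.P Kt).m + (F.P Kt).K)
    (Z Λ : Set (Site (F.P Kt) 0)) (T : Finset (PBond (F.P Kt) k)) (lo hi : Fin (F.P Kt).d → ℤ)
    (hbox : ∀ κ, ((((hi κ - lo κ + 1).toNat + 3 : ℕ) : ℤ)) ≤ (F.P Kt).sitesPerDir k)
    (hΩw : ∀ (ν' : Fin (F.P Kt).d), ∀ z ∈ box (fun κ => (hi κ - lo κ + 1).toNat + 3) (fun κ => lo κ - 2),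
      (castSite z : Site (F.P Kt) k) ∈ pts k (maxDomT ν.M₁ Z k) ∧ (castSite z : Site (F.P Kt) k).shift ⟨0, h0⟩ ∈ pts k (maxDomT ν.M₁ Z k) ∧
        (castSite z : Site (F.P Kt) k).shift ν' ∈ pts k (maxDomT ν.M₁ Z k)) :
    ∃ C ρ Kτ ρτ : ℝ, 0 ≤ C ∧ 0 < ρ ∧ 0 ≤ Kτ ∧ 0 < ρτ ∧
      ∀ (ext : GaugeField (F.P Kt) k SU2 → GaugeField (F.P Kt) k SU2) (Vk : GaugeField (F.P Kt) k SU2) ⦃R 𝓐₀ : ℝ⦄, 0 < R → 0 ≤ 𝓐₀ →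
      ∀ (U₀ : GaugeField (F.P Kt) 0 SU2) (Xf : GaugeSlice (pts k Λ) T E3 → PBond (F.P Kt) 0 → lieSU (Fin 2)),
      IsMinimizer (Node00.avOfRecord F 2 Kt) (Node00.regMSCoPOfRecord F 2 ν Kt k (maxDomT ν.M₁ Z)) (Bj ν.M₁ Z k)
        (avgFamily (Node00.avOfRecord F 2 Kt) (qsstarGIter0 k (ext Vk))) U₀ →
      SmallBelow (Node00.avOfRecord F 2 Kt) k U₀ →
      ∀ ⦃εP : ℝ⦄, 0 ≤ εP →
      (∀ p : Plaq (F.P Kt) 0, ((⟨p.src, p.μ⟩ : PBond (F.P Kt) 0) ∈ {b : PBond (F.P Kt) 0 | b.src ∈ maxDomT ν.M₁ Z 1} ∨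
          (⟨p.src.shift p.μ, p.ν⟩ : PBond (F.P Kt) 0) ∈ {b : PBond (F.P Kt) 0 | b.src ∈ maxDomT ν.M₁ Z 1} ∨
          (⟨p.src.shift p.ν, p.μ⟩ : PBond (F.P Kt) 0) ∈ {b : PBond (F.P Kt) 0 | b.src ∈ maxDomT ν.M₁ Z 1} ∨
          (⟨p.src, p.ν⟩ : PBond (F.P Kt) 0) ∈ {b : PBond (F.P Kt) 0 | b.src ∈ maxDomT ν.M₁ Z 1}) →
        ‖((GaugeField.plaqHol U₀ p : SU2) : Matrix (Fin 2) (Fin 2) ℂ) - 1‖ ≤ εP) →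
      ∀ (H : (Fin (constrCard (Bj ν.M₁ Z k) k) → lieSU (Fin 2)) → PBond (F.P Kt) 0 → lieSU (Fin 2)) ⦃B : ℝ⦄, 0 ≤ B →
      (∀ v, fderiv ℝ (msChart F 2 Kt k (Bj ν.M₁ Z k) (avgFamily (avOfRecord F 2 Kt) (qsstarGIter0 k (ext Vk))) U₀) 0 (H v) = v) →
      (∀ v, Real.sqrt (∑ b, ‖H v b‖ ^ 2) ≤ B * ‖v‖) →
      ∀ ⦃M₂ : ℝ⦄, 0 ≤ M₂ → (∀ w, ‖fderiv ℝ (fderiv ℝ (msChart F 2 Kt k (Bj ν.M₁ Z k) (avgFamily (avOfRecord F 2 Kt) (qsstarGIter0 k (ext Vk))) U₀)) 0 w w‖ ≤ M₂ * ‖w‖ ^ 2) →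
      Xf 0 = 0 → ContDiffAt ℝ 2 Xf 0 →
      (∀ᶠ Y in 𝓝 (0 : GaugeSlice (pts k Λ) T E3),
        IsMinimizer (Node00.avOfRecord F 2 Kt) (Node00.regMSCoPOfRecord F 2 ν Kt k (maxDomT ν.M₁ Z)) (Bj ν.M₁ Z k)
          (avgFamily (Node00.avOfRecord F 2 Kt) (qsstarGIter0 k (expMul su2Chart (ιA (pts k Λ) T Y) (ext Vk)))) (expChart U₀ (Xf Y))) →
      (∀ (X : GaugeSlice (pts k Λ) T E3) (b : PBond (F.P Kt) 0),
        ‖((fderiv ℝ Xf 0 X b : lieSU (Fin 2)) : Matrix (Fin 2) (Fin 2) ℂ)‖ ≤ 8 * 𝓐₀ / R * ‖X‖ ∧ ‖fderiv ℝ Xf 0 X b‖ ≤ 12 * 𝓐₀ / R * ‖X‖) →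
      (∀ (X : GaugeSlice (pts k Λ) T E3) (b : PBond (F.P Kt) 0), b.src ∉ maxDomT ν.M₁ Z 1 → fderiv ℝ Xf 0 X b = 0) →
      ∀ (W : Finset (Plaq (F.P Kt) 0)),
      (∀ q : Plaq (F.P Kt) 0, q.src ∈ ((box (fun κ => (F.P Kt).L ^ k * ((hi κ - lo κ + 1).toNat + 3 + 1) - 1) (fun κ => ((F.P Kt).L : ℤ) ^ k * (lo κ - 2))).image
          (fun z => (castSite z : Site (F.P Kt) 0))) → q ∈ W) →
      ∀ ⦃δW : ℝ⦄, 0 < δW → δW < ρ → δW < ρτ →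
      (∀ (ν' : Fin (F.P Kt).d), ∀ z ∈ box (fun κ => (hi κ - lo κ + 1).toNat + 3) (fun κ => lo κ - 2), ∀ b₀ : PBond (F.P Kt) 0,
        (b₀ ∈ feeds k (⟨(castSite z : Site (F.P Kt) k), ⟨0, h0⟩⟩ : PBond (F.P Kt) k) ∨ b₀ ∈ feeds k (⟨((castSite z : Site (F.P Kt) k)).shift ⟨0, h0⟩, ν'⟩ : PBond (F.P Kt) k)
        ∨ b₀ ∈ feeds k (⟨((castSite z : Site (F.P Kt) k)).shift ν', ⟨0, h0⟩⟩ : PBond (F.P Kt) k) ∨ b₀ ∈ feeds k (⟨(castSite z : Site (F.P Kt) k), ν'⟩ : PBond (F.P Kt) k)) →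
        ‖((U₀ b₀ : SU2) : Matrix (Fin 2) (Fin 2) ℂ) - 1‖ ≤ δW) →
      ∃ (Ψ₂ : (PBond (F.P Kt) 0 → lieSU (Fin 2)) →L[ℝ] (PBond (F.P Kt) 0 → lieSU (Fin 2)) →L[ℝ] (Fin (constrCard (Bj ν.M₁ Z k) k) → lieSU (Fin 2)))
        (lam : (Fin (constrCard (Bj ν.M₁ Z k) k) → lieSU (Fin 2)) →L[ℝ] ℝ)
        (p : Seminorm ℝ (PBond (F.P Kt) 0 → lieSU (Fin 2))),
        HasFDerivAt (fun Y => fderiv ℝ (msChart F 2 Kt k (Bj ν.M₁ Z k) (avgFamily (avOfRecord F 2 Kt) (qsstarGIter0 k (ext Vk))) U₀) Y) Ψ₂ 0 ∧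
        (∀ᶠ Y in 𝓝 (0 : PBond (F.P Kt) 0 → lieSU (Fin 2)), DifferentiableAt ℝ (msChart F 2 Kt k (Bj ν.M₁ Z k) (avgFamily (avOfRecord F 2 Kt) (qsstarGIter0 k (ext Vk))) U₀) Y) ∧
        fderiv ℝ (fun Y : PBond (F.P Kt) 0 → lieSU (Fin 2) => wilsonAction4 (expChart U₀ Y)) 0 = lam.comp (fderiv ℝ (msChart F 2 Kt k (Bj ν.M₁ Z k) (avgFamily (avOfRecord F 2 Kt) (qsstarGIter0 k (ext Vk))) U₀) 0) ∧
        (∀ Y : PBond (F.P Kt) 0 → lieSU (Fin 2), ∑ b, ‖(Y b : Matrix (Fin 2) (Fin 2) ℂ)‖ ^ 2 ≤ p Y ^ 2) ∧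
        ∀ X : GaugeSlice (pts k Λ) T E3,
          lam (Ψ₂ (fderiv ℝ Xf 0 X) (fderiv ℝ Xf 0 X))
              ≤ (2 * (((F.P Kt).d : ℝ) - 1) * εP * Real.sqrt (Fintype.card (PBond (F.P Kt) 0)) * B * M₂) * p (fderiv ℝ Xf 0 X) ^ 2 ∧
          p (fderiv ℝ Xf 0 X) ≤ (12 * 𝓐₀ / R * Real.sqrt (Nat.card {b : PBond (F.P Kt) 0 // b.src ∈ maxDomT ν.M₁ Z 1})) * ‖X‖ ∧
          (((F.P Kt).L : ℝ) ^ (F.P Kt).d) ^ k / ((((F.P Kt).L : ℝ)) ^ 2 * ((F.P Kt).L : ℝ) ^ 2) ^ k / 2 * (∑ z ∈ box (fun κ => (hi κ - lo κ + 1).toNat + 3) (fun κ => lo κ - 2), ∑ μ : Fin (F.P Kt).d, ∑ a : Fin 3, curl (fun b => ιA (pts k Λ) T X (⟨castSite b.1, b.2⟩ : PBond (F.P Kt) k) a) z ⟨0, h0⟩ μ ^ 2)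
              - (((F.P Kt).L : ℝ) ^ (F.P Kt).d) ^ k / ((((F.P Kt).L : ℝ)) ^ 2 * ((F.P Kt).L : ℝ) ^ 2) ^ k * (8 * (((F.P Kt).d : ℝ) + 1) * (2 * (Kτ + 1) * δW) + 8 * ((F.P Kt).d : ℝ) * (((box (fun κ => (hi κ - lo κ + 1).toNat + 3) (fun κ => lo κ - 2)).image (fun z => (castSite z : Site (F.P Kt) k))).card : ℝ) * (C * δW * (12 * 𝓐₀ / R * Real.sqrt (Nat.card {b : PBond (F.P Kt) 0 // b.src ∈ maxDomT ν.M₁ Z 1}))) ^ 2) * ‖X‖ ^ 2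
            ≤ ((Fintype.card (Fin 2) : ℝ)⁻¹ • ∑ p ∈ W, (innerSL ℝ (E := lieSU (Fin 2))).bilinearComp
              (ContinuousLinearMap.proj (R := ℝ) (φ := fun _ : PBond (F.P Kt) 0 => lieSU (Fin 2)) (⟨p.src, p.μ⟩ : PBond (F.P Kt) 0) + ContinuousLinearMap.proj (R := ℝ) (φ := fun _ : PBond (F.P Kt) 0 => lieSU (Fin 2)) (⟨p.src.shift p.μ, p.ν⟩ : PBond (F.P Kt) 0)
                - ContinuousLinearMap.proj (R := ℝ) (φ := fun _ : PBond (F.P Kt) 0 => lieSU (Fin 2)) (⟨p.src.shift p.ν, p.μ⟩ : PBond (F.P Kt) 0) - ContinuousLinearMap.proj (R := ℝ) (φ := fun _ : PBond (F.P Kt) 0 => lieSU (Fin 2)) (⟨p.src, p.ν⟩ : PBond (F.P Kt) 0) : (PBond (F.P Kt) 0 → lieSU (Fin 2)) →L[ℝ] lieSU (Fin 2))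
              (ContinuousLinearMap.proj (R := ℝ) (φ := fun _ : PBond (F.P Kt) 0 => lieSU (Fin 2)) (⟨p.src, p.μ⟩ : PBond (F.P Kt) 0) + ContinuousLinearMap.proj (R := ℝ) (φ := fun _ : PBond (F.P Kt) 0 => lieSU (Fin 2)) (⟨p.src.shift p.μ, p.ν⟩ : PBond (F.P Kt) 0)
                - ContinuousLinearMap.proj (R := ℝ) (φ := fun _ : PBond (F.P Kt) 0 => lieSU (Fin 2)) (⟨p.src.shift p.ν, p.μ⟩ : PBond (F.P Kt) 0) - ContinuousLinearMap.proj (R := ℝ) (φ := fun _ : PBond (F.P Kt) 0 => lieSU (Fin 2)) (⟨p.src, p.ν⟩ : PBond (F.P Kt) 0) : (PBond (F.P Kt) 0 → lieSU (Fin 2)) →L[ℝ] lieSU (Fin 2))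
              : (PBond (F.P Kt) 0 → lieSU (Fin 2)) →L[ℝ] (PBond (F.P Kt) 0 → lieSU (Fin 2)) →L[ℝ] ℝ) (fderiv ℝ Xf 0 X) (fderiv ℝ Xf 0 X) := by
  classical
  -- ### the `linAvg` iterate and the explicit junction seminorm (for the velocity-form clause's constants)
  let Q : (i : ℕ) → (PBond (F.P Kt) 0 → Matrix (Fin 2) (Fin 2) ℂ) → PBond (F.P Kt) i → Matrix (Fin 2) (Fin 2) ℂ := fun i =>
    Nat.rec (motive := fun i => (PBond (F.P Kt) 0 → Matrix (Fin 2) (Fin 2) ℂ) → PBond (F.P Kt) i → Matrix (Fin 2) (Fin 2) ℂ)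
      (fun Y => Y) (fun _ q Y c => linAvg (q Y) c) i
  have hQ0 : ∀ Y, Q 0 Y = Y := fun Y => rfl
  have hQs : ∀ (i : ℕ) (Y : PBond (F.P Kt) 0 → Matrix (Fin 2) (Fin 2) ℂ) (c : PBond (F.P Kt) (i + 1)), Q (i + 1) Y c = linAvg (Q i Y) c :=
    fun i Y c => rfl
  let p₀ : Seminorm ℝ (PBond (F.P Kt) 0 → lieSU (Fin 2)) :=
    (normSeminorm ℝ (PiLp 2 (fun _ : PBond (F.P Kt) 0 => lieSU (Fin 2)))).comp (WithLp.linearEquiv 2 ℝ (PBond (F.P Kt) 0 → lieSU (Fin 2))).symm.toLinearMap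
  have hp₀ : ∀ Y : PBond (F.P Kt) 0 → lieSU (Fin 2), ∑ b, ‖(Y b : Matrix (Fin 2) (Fin 2) ℂ)‖ ^ 2 ≤ p₀ Y ^ 2 := fun Y => sum_opNorm_sq_le_l2Seminorm_sq Y
  -- ### the per-height constants
  obtain ⟨C, ρ, hC, hρ, hmX⟩ := exists_hmX_federbush_window_of_isMinimizer_family (F := F) (K := Kt) (M₁ := ν.M₁) h0 hk Q hQ0 hQs p₀ hp₀
  obtain ⟨Kτ, ρτ, hKτ, hρτ, htw⟩ := exists_twistSize_of_nearFlat_feeds (F := F) (N := 2) Kt k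
  refine ⟨C, ρ, Kτ, ρτ, hC, hρ, hKτ, hρτ, ?_⟩
  intro ext Vk R 𝓐₀ hR h𝓐₀ U₀ Xf hmin0 hsb εP hεP0 hP H B hB0 hHinv hHB M₂ hM₂0 hM₂ hX₀ hXc hmin hKb hsupp W hWin δW hδW0 hδWρ hδWτ hδW
  -- ### the chart rows (P1)
  obtain ⟨Ψ₂, lam, p, hΨ₂, hΨd, hlam, hp, -, hrows⟩ :=
    chartRows_direct_of_letters' ν Kt hk0 Z Λ T ext Vk hR h𝓐₀ U₀ Xf hmin0 hsb hεP0 hP H hB0 hHinv hHB hM₂0 hM₂ hKb hsupp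
  refine ⟨Ψ₂, lam, p, hΨ₂, hΨd, hlam, hp, fun X => ⟨(hrows X).1, (hrows X).2, ?_⟩⟩
  -- ### the velocity-form Federbush clause: region letters discharged by the block tower of the box (as p646479 §1)
  have hUfib : AgreeOn (Bj ν.M₁ Z k) (avgFamily (avOfRecord F 2 Kt) U₀) (avgFamily (avOfRecord F 2 Kt) (qsstarGIter0 k (ext Vk))) := hmin0.2.1
  let Sset : (i : ℕ) → Finset (Site (F.P Kt) i) := fun i =>
    (box (fun κ => (F.P Kt).L ^ (k - i) * (((hi κ - lo κ + 1).toNat + 3) + 1) - 1) (fun κ => ((F.P Kt).L : ℤ) ^ (k - i) * (lo κ - 2))).image (fun z => (castSite z : Site (F.P Kt) i))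
  have hSk : Sset k = (box (fun κ => (hi κ - lo κ + 1).toNat + 3) (fun κ => lo κ - 2)).image (fun z => (castSite z : Site (F.P Kt) k)) := by
    simp only [Sset, Nat.sub_self, pow_zero, one_mul, Nat.add_sub_cancel]
  have hwin : ∀ z ∈ box (fun κ => (hi κ - lo κ + 1).toNat + 3) (fun κ => lo κ - 2), (castSite z : Site (F.P Kt) k) ∈ Sset k := fun z hz => by
    rw [hSk]
    exact Finset.mem_image_of_mem _ hz
  have hS : ∀ (ν' : Fin (F.P Kt).d), (⟨0, h0⟩ : Fin (F.P Kt).d) ≠ ν' → ∀ i, i < k → ∀ y ∈ Sset (i + 1), ∀ (r : Fin (F.P Kt).d → Fin (F.P Kt).L) (s t : ℕ),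
      s < (F.P Kt).L → t < (F.P Kt).L → runSite (runSite (Site.blockSite y r) ⟨0, h0⟩ s) ν' t ∈ Sset i := by
    intro ν' hν i hi y hy r s t hs ht
    exact runSite_runSite_blockSite_mem_tower h0 (lt_of_lt_of_le hi hk) hν hi hy r hs ht
  have hΩk : ∀ (ν' : Fin (F.P Kt).d), ∀ s ∈ Sset k, s ∈ pts k (maxDomT ν.M₁ Z k) ∧ s.shift ⟨0, h0⟩ ∈ pts k (maxDomT ν.M₁ Z k) ∧ s.shift ν' ∈ pts k (maxDomT ν.M₁ Z k) := by
    intro ν' s hs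
    rw [hSk, Finset.mem_image] at hs
    obtain ⟨z, hz, rfl⟩ := hs
    exact hΩw ν' z hz
  have hW0 : ∀ q : Plaq (F.P Kt) 0, q.src ∈ Sset 0 → q ∈ W := fun q hq => hWin q (by simpa only [Sset, Nat.sub_zero] using hq)
  have hcons := hcons_of_plaqsInside_maxDomT h0 Z (Sset k) hΩk
  -- near-flatness on the feeds of the region's plaquette bonds, re-indexed through `S_k = castSite″ box`
  have hδW' : ∀ (ν' : Fin (F.P Kt).d), ∀ s ∈ Sset k, ∀ b₀ : PBond (F.P Kt) 0,
      (b₀ ∈ feeds k (⟨s, ⟨0, h0⟩⟩ : PBond (F.P Kt) k) ∨ b₀ ∈ feeds k (⟨(s).shift ⟨0, h0⟩, ν'⟩ : PBond (F.P Kt) k)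
        ∨ b₀ ∈ feeds k (⟨(s).shift ν', ⟨0, h0⟩⟩ : PBond (F.P Kt) k) ∨ b₀ ∈ feeds k (⟨s, ν'⟩ : PBond (F.P Kt) k)) →
      ‖((U₀ b₀ : SU 2) : Matrix (Fin 2) (Fin 2) ℂ) - 1‖ ≤ δW := by
    intro ν' s hs b₀ hb₀
    rw [hSk, Finset.mem_image] at hs
    obtain ⟨z, hz, rfl⟩ := hs
    exact hδW ν' z hz b₀ hb₀
  -- the twist size at the region's plaquette bonds from the tower near-flatness
  have htwb : ∀ (c : PBond (F.P Kt) k), c ∈ bondsOf (Bj ν.M₁ Z k k) →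
      (∀ b₀ ∈ feeds k c, ‖((U₀ b₀ : SU 2) : Matrix (Fin 2) (Fin 2) ℂ) - 1‖ ≤ δW) →
      ‖((avgFamily (avOfRecord F 2 Kt) (qsstarGIter0 k (ext Vk)) k c : SU 2) : Matrix (Fin 2) (Fin 2) ℂ) - 1‖ ≤ (2 * (Kτ + 1) * δW) / 2 := by
    intro c hc hloc
    have h := htw (Bj ν.M₁ Z k) (avgFamily (avOfRecord F 2 Kt) (qsstarGIter0 k (ext Vk))) U₀ hk hUfib c hc hδW0.le hδWτ hloc
    have h2 : Kτ * δW ≤ (2 * (Kτ + 1) * δW) / 2 := by nlinarith [hδW0.le]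
    exact h.trans h2
  have hW' : ∀ (ν' : Fin (F.P Kt).d), ∀ s ∈ Sset k,
      ‖((avgFamily (avOfRecord F 2 Kt) (qsstarGIter0 k (ext Vk)) k ⟨s, ⟨0, h0⟩⟩ : SU 2) : Matrix (Fin 2) (Fin 2) ℂ) - 1‖ ≤ (2 * (Kτ + 1) * δW) / 2 ∧
      ‖((avgFamily (avOfRecord F 2 Kt) (qsstarGIter0 k (ext Vk)) k ⟨s.shift ⟨0, h0⟩, ν'⟩ : SU 2) : Matrix (Fin 2) (Fin 2) ℂ) - 1‖ ≤ (2 * (Kτ + 1) * δW) / 2 ∧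
      ‖((avgFamily (avOfRecord F 2 Kt) (qsstarGIter0 k (ext Vk)) k ⟨s.shift ν', ⟨0, h0⟩⟩ : SU 2) : Matrix (Fin 2) (Fin 2) ℂ) - 1‖ ≤ (2 * (Kτ + 1) * δW) / 2 ∧
      ‖((avgFamily (avOfRecord F 2 Kt) (qsstarGIter0 k (ext Vk)) k ⟨s, ν'⟩ : SU 2) : Matrix (Fin 2) (Fin 2) ℂ) - 1‖ ≤ (2 * (Kτ + 1) * δW) / 2 := by
    intro ν' s hs
    obtain ⟨h1, h2, h3, h4⟩ := hcons ν' s hs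
    exact ⟨htwb _ h1 fun b₀ hb₀ => hδW' ν' s hs b₀ (Or.inl hb₀), htwb _ h2 fun b₀ hb₀ => hδW' ν' s hs b₀ (Or.inr (Or.inl hb₀)),
      htwb _ h3 fun b₀ hb₀ => hδW' ν' s hs b₀ (Or.inr (Or.inr (Or.inl hb₀))), htwb _ h4 fun b₀ hb₀ => hδW' ν' s hs b₀ (Or.inr (Or.inr (Or.inr hb₀)))⟩
  have hτ : 0 < (2 * (Kτ + 1) * δW) := by positivity
  have hΨ : DifferentiableAt ℝ (msChart F 2 Kt k (Bj ν.M₁ Z k) (avgFamily (avOfRecord F 2 Kt) (qsstarGIter0 k (ext Vk))) U₀) 0 := differentiableAt_msChart hUfib hsb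
  have hX1 : HasFDerivAt Xf (fderiv ℝ Xf 0) 0 := (hXc.differentiableAt two_ne_zero).hasFDerivAt
  have hη0 : (0 : ℝ) < 1 / 2 := by norm_num
  have hη1 : (1 : ℝ) / 2 < 1 := by norm_num
  -- (K) for the explicit seminorm `p₀`
  have hK0 : ∀ X' : GaugeSlice (pts k Λ) T E3, p₀ (fderiv ℝ Xf 0 X') ≤ (12 * 𝓐₀ / R * Real.sqrt (Nat.card {b : PBond (F.P Kt) 0 // b.src ∈ maxDomT ν.M₁ Z 1})) * ‖X'‖ := by
    intro X'
    have ha : 0 ≤ 12 * 𝓐₀ / R * ‖X'‖ := by positivity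
    have h := l2Seminorm_le_of_bound_of_support (N := 2) (maxDomT ν.M₁ Z 1) (fderiv ℝ Xf 0 X') ha (fun b => (hKb X' b).2) (fun b hb => hsupp X' b hb)
    calc p₀ (fderiv ℝ Xf 0 X') ≤ Real.sqrt (Nat.card {b : PBond (F.P Kt) 0 // b.src ∈ maxDomT ν.M₁ Z 1}) * (12 * 𝓐₀ / R * ‖X'‖) := h
      _ = (12 * 𝓐₀ / R * Real.sqrt (Nat.card {b : PBond (F.P Kt) 0 // b.src ∈ maxDomT ν.M₁ Z 1})) * ‖X'‖ := by ring
  -- the velocity-form clause at `η = 1∕2` (Pauli coordinates eliminated in term mode)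
  have key := exists_lieSU2Coord.elim fun φ hφ =>
    hmX Z X (fun κ => lo κ - 2) hbox Sset hwin hS hφ hΩk (regMSCoPOfRecord F 2 ν Kt k (maxDomT ν.M₁ Z)) (ext Vk) U₀ hX₀ hmin hX1 hΨ hτ hW' W hW0 hδW0.le hδWρ hδW' hη0 hη1
  -- arithmetic: `(C·δ_W·p₀(X_f′X))² ≤ (C·δ_W·Kc)²‖X‖²`, `|S_k|` of the statement = `(S_k).card`
  have hcard : ((Sset k).card : ℝ) = (((box (fun κ => (hi κ - lo κ + 1).toNat + 3) (fun κ => lo κ - 2)).image (fun z => (castSite z : Site (F.P Kt) k))).card : ℝ) := by rw [hSk]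
  have hpK : (C * δW * p₀ (fderiv ℝ Xf 0 X)) ^ 2 ≤ (C * δW * (12 * 𝓐₀ / R * Real.sqrt (Nat.card {b : PBond (F.P Kt) 0 // b.src ∈ maxDomT ν.M₁ Z 1}))) ^ 2 * ‖X‖ ^ 2 := by
    have h1 : 0 ≤ C * δW * p₀ (fderiv ℝ Xf 0 X) := by positivity
    have h2 : C * δW * p₀ (fderiv ℝ Xf 0 X) ≤ C * δW * ((12 * 𝓐₀ / R * Real.sqrt (Nat.card {b : PBond (F.P Kt) 0 // b.src ∈ maxDomT ν.M₁ Z 1})) * ‖X‖) := mul_le_mul_of_nonneg_left (hK0 X) (by positivity)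
    calc (C * δW * p₀ (fderiv ℝ Xf 0 X)) ^ 2 ≤ (C * δW * ((12 * 𝓐₀ / R * Real.sqrt (Nat.card {b : PBond (F.P Kt) 0 // b.src ∈ maxDomT ν.M₁ Z 1})) * ‖X‖)) ^ 2 := pow_le_pow_left₀ h1 h2 2
      _ = (C * δW * (12 * 𝓐₀ / R * Real.sqrt (Nat.card {b : PBond (F.P Kt) 0 // b.src ∈ maxDomT ν.M₁ Z 1}))) ^ 2 * ‖X‖ ^ 2 := by ring
  have hratio : 0 ≤ (((F.P Kt).L : ℝ) ^ (F.P Kt).d) ^ k / ((((F.P Kt).L : ℝ)) ^ 2 * ((F.P Kt).L : ℝ) ^ 2) ^ k := by positivity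
  have hinv : ((1 : ℝ) / 2)⁻¹ - 1 = 1 := by norm_num
  have hhalf : (1 : ℝ) - 1 / 2 = 1 / 2 := by norm_num
  rw [hinv, hhalf, one_mul, hcard] at key
  have h3 : (((F.P Kt).L : ℝ) ^ (F.P Kt).d) ^ k / ((((F.P Kt).L : ℝ)) ^ 2 * ((F.P Kt).L : ℝ) ^ 2) ^ k * (8 * ((F.P Kt).d : ℝ) * (((box (fun κ => (hi κ - lo κ + 1).toNat + 3) (fun κ => lo κ - 2)).image (fun z => (castSite z : Site (F.P Kt) k))).card : ℝ) * (C * δW * p₀ (fderiv ℝ Xf 0 X)) ^ 2)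
      ≤ (((F.P Kt).L : ℝ) ^ (F.P Kt).d) ^ k / ((((F.P Kt).L : ℝ)) ^ 2 * ((F.P Kt).L : ℝ) ^ 2) ^ k * (8 * ((F.P Kt).d : ℝ) * (((box (fun κ => (hi κ - lo κ + 1).toNat + 3) (fun κ => lo κ - 2)).image (fun z => (castSite z : Site (F.P Kt) k))).card : ℝ) * ((C * δW * (12 * 𝓐₀ / R * Real.sqrt (Nat.card {b : PBond (F.P Kt) 0 // b.src ∈ maxDomT ν.M₁ Z 1}))) ^ 2 * ‖X‖ ^ 2)) :=
    mul_le_mul_of_nonneg_left (mul_le_mul_of_nonneg_left hpK (by positivity)) hratio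
  refine le_trans ?_ key
  linarith [h3]

end Package

end Summit.QuantumFields.YangMills.BalabanUVNodes.N12DirectChartPackageRepaired

end
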